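/-
Copyright (c) 2026 the pub-hodgecm-mathlib formalisation cell (harness21).  Prover seat hodgecm-mathlib-K2E4-p01 (g3), Track B «K2-LIT» ∕ h413
(stmt-HodgeConjecture-24833), socket #22S road, F-B re-cut (RK2_v): (R2) THE JOINT LETTER (GS+RK2)_v′ — two explicit `Δ‴_v`-transfer pairs with
independent germ pairs on the (GS) ray at a split place.  2026-09-04.
-/
import Summits.HodgeConjecture.HodgeConjecture.Theorems.K2E3CentralGermShellKitSplit       -- ★ (T⁺, this seat): the shell kit at a split place, frame `j_w`
import Summits.HodgeConjecture.HodgeConjecture.Theorems.K2E4SplitTransferConeAlgebra        -- ★ (R1, this seat): the `GL₃` cone algebra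
import Summits.HodgeConjecture.HodgeConjecture.Theorems.K2E3GermConstantRegularHRSplit      -- ★ p854983 (K2E4-p07): `exists_isLocSmooth_cmSplitTransfer_apply_ne_zero`, `prefactor_ne_zero`, the split frame
import Literature.NumberTheory.Rogawski1990.UnitFundamentalLemmaSplitPlaceLeviSides         -- ★ `reindexGL_finSumFinEquiv_blockDiagGL_mem_glInt_iff`
import HarnessLib

/-!
# h413 ∕ Track B «K2-LIT» — (R2) THE JOINT LETTER (GS+RK2)_v′: at a split place, the H-side central germ structure TOGETHER WITH two explicit
# `Δ‴_v`-transfer pairs `(τ_v·f̄ᵢ^P, fᵢ)` whose germ pairs along the SAME ray are linearly independent (★ p855314's `hGS ∧ hRK`)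

Cell `pub/hodgecm-mathlib`, crux H413 = `stmt-HodgeConjecture-24833` (supports-only).  Socket #22S `WeakMatrixRigidity.sig_K2E4WeakMatrixFiniteTransportSplit`
= ★ `K2E4WeakMatrixFiniteTransportSplitOfRankTwo.weakMatrixFiniteTransportSplit_of_rankTwo` (K2E4-p07 (g3)) applied to THIS FILE's theorem (K2E4-plan (g2) RULING
01:12:36Z: F-B re-cut (2); letter bytes consumer-drafted `K2/K2E4-p07/g3/GSRK.sig.K2E4-p07-g3.lean` with K2E4-r02's binder fix `[νHv.IsHaarMeasure]`).
**`centralGermStructureRankTwo_split`**.  PROOF.  Ray, `G`, `λ`, `λ′`, (GS) clause and the SHELL KIT from ★ (T⁺) `centralGermShellKit_split` (fed by ★ (GS^P⁺));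
`f₁` := ★ p854983's test function (`τ_v·f̄₁^P((γ_H)_v) ≠ 0`); `f₂ := 1_{e′⁻¹ D}`, `D := y_G·K(ϖ^N)` a compact open neighbourhood of the Levi image `y_G = m(Y)` of the kit's
limit `Y` of the deepest shells, chosen OFF the closed cone `Z = {(g − e₁)(g − e₂) = 0}` (★ (R1) `shell_not_cone`; ★ `exists_congruenceGL_pow_subset`); both transfers
`fH′ᵢ := UnitaryGroup.cmSplitTransfer fᵢ` are smooth `Δ‴_v`-pairs (★ `isLocalDeltaTransfer_cmSplitTransfer`).  The constant term `f̄₂^P(h) = δ^{1∕2}(m_h)·(κ⊗μ_U){(k,u) : k m_h u k⁻¹ ∈ D}`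
(★ `UnitaryGroup.cmConstantTermSplit_apply`): at `h = (γ_H)_v` the integrand lives on `Z` (★ (R1) `cone_diag_mul_unipotent`, `cone_conj`) so `fH′₂((γ_H)_v) = 0`; on the conjugates of
`γ_n` the phase `c·τ_v(det)·δ^{1∕2}` is CONSTANT (characters) and the mass is `≥ 0`; at `k y_n k⁻¹` (`j_w k ∈ K_P`, `m(y_n) ∈ D`) the mass is `> 0` (open set ∋ `(m_k⁻¹, 1)`
of finite mass) — so the kit's criterion gives `Φ^st_H(fH′₂)(γ_n) ≠ 0` for `n ≫ 0`, and the (GS) central-value clause forces `a′₁b′₂ − a′₂b′₁ ≠ 0`.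

HONEST LABEL: HC_CM is proved only modulo the 7 printed citations (2 remaining named inputs: hLiu418 = `stmt-HodgeConjecture-24832`,
h413 = `stmt-HodgeConjecture-24833`) until rung 0 closes; this file is an unconditional local theorem and moves no counter by itself; #22S is a bridge.

## References
* [Rogawski1990] J. D. Rogawski, *Automorphic Representations of Unitary Groups in Three Variables* (1990), §4.13 Lemma 4.13.1 (a) pp. 64–66; §8.1 pp. 114–116; §4.9 p. 55.
* [LabesseLanglands1979] J.-P. Labesse, R. P. Langlands, *L-indistinguishability for SL(2)*, Canad. J. Math. 31 (1979), §2 pp. 7–9.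
* [HarishChandra1999AdmissibleDistributions] Harish-Chandra (DeBacker–Sally), *Admissible Invariant Distributions on Reductive p-adic Groups* (1999), Thm. 3.1.
-/

set_option autoImplicit false
set_option linter.dupNamespace false

noncomputable section

open MeasureTheory Measure NumberField IsDedekindDomain TopologicalSpace Filter
open Literature.MeasureTheory.Group
open Literature.NumberTheory.Rogawski1990 Literature.NumberTheory.Automorphic Literature.NumberTheory.GaloisRepresentations
open Literature.AlgebraicGeometry.ShimuraVarieties (unitaryGroup hermForm)
open Summit.HodgeConjecture.HodgeConjecture.Cruxes.H413
open scoped Matrix MatrixGroups NNReal ENNReal Pointwise Topology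

namespace Summit.HodgeConjecture.HodgeConjecture.Cruxes.H413.K2E4SplitTransferRankTwo

set_option maxHeartbeats 3200000 in
set_option synthInstance.maxHeartbeats 400000 in
/-- **(GS+RK2)_v′ — THE JOINT LETTER AT A SPLIT PLACE.**  For `L∕L⁺` CM, `H′` anisotropic hermitian, a place `v` of `L⁺` split in `L`, a Haar `νHv` on `H_v` and `νGv` on `G′_v`,
canonical orbital measure families `mHv`, `mGv`, a unitary `μ` restricting to `ω_{L∕L⁺}`, and `γ_H = (e₁·1₂, e₂)` with `e₁ ≠ e₂`: there are a `G`-regular ray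
`γ_n → (γ_H)_v`, `G` with infinite range, `λ ≠ 0`, `λ′` with (GS) `Φ^st_H(φ)(γ_n) = a + b·G_n ∧ φ((γ_H)_v) = λa + λ′b` for every smooth `φ`, an H-side rank-two pair, AND
two explicit smooth `Δ‴_v`-transfer pairs `(fH′ᵢ, fᵢ)` (`fH′ᵢ = τ_v·f̄ᵢ^P`) with germ pairs `(a′ᵢ, b′ᵢ)` along the ray and `a′₁b′₂ − a′₂b′₁ ≠ 0`.  Statement = K2E4-p07 (g3)'s
letter `K2/K2E4-p07/g3/GSRK.sig.K2E4-p07-g3.lean` with `[νHv.IsHaarMeasure]` (K2E4-r02 (g2) 01:13:34Z), the hypothesis `hGSRK` of ★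
`K2E4WeakMatrixFiniteTransportSplitOfRankTwo.weakMatrixFiniteTransportSplit_of_rankTwo`.
[cite: Rogawski1990, §4.13 Lemma 4.13.1 (a) pp. 64–66; §8.1 Props. 8.1.1–8.1.3 pp. 114–116] [cite: LabesseLanglands1979, §2 pp. 7–9] [cite: HarishChandra1999AdmissibleDistributions, Thm. 3.1] -/
theorem centralGermStructureRankTwo_split :
    ∀ (L : Type) [Field L] [NumberField L] [IsCMField L] (H' : Matrix (Fin 3) (Fin 3) L),
      (H'.map (cmConjRingHom L)).transpose = H' →
      (∀ x : Fin 3 → L, hermForm (cmConjRingHom L) H' x x = 0 → x = 0) →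
    ∀ (v : HeightOneSpectrum (𝓞 ↥(maximalRealSubfield L))), ¬ Subsingleton (UnitaryGroup.PlacesOver L v) →
    ∀
      [MeasurableSpace ((UnitaryGroup.cmDatum L 2 (Matrix.of fun i j : Fin 2 => if i.val + j.val + 1 = 2 then (1 : L) else 0)).Local v × (UnitaryGroup.cmDatum L 1 (Matrix.of fun i j : Fin 1 => if i.val + j.val + 1 = 1 then (1 : L) else 0)).Local v)] [BorelSpace ((UnitaryGroup.cmDatum L 2 (Matrix.of fun i j : Fin 2 => if i.val + j.val + 1 = 2 then (1 : L) else 0)).Local v × (UnitaryGroup.cmDatum L 1 (Matrix.of fun i j : Fin 1 => if i.val + j.val + 1 = 1 then (1 : L) else 0)).Local v)]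
      [∀ a : ((UnitaryGroup.cmDatum L 2 (Matrix.of fun i j : Fin 2 => if i.val + j.val + 1 = 2 then (1 : L) else 0)).Local v × (UnitaryGroup.cmDatum L 1 (Matrix.of fun i j : Fin 1 => if i.val + j.val + 1 = 1 then (1 : L) else 0)).Local v),
        MeasurableSpace (((UnitaryGroup.cmDatum L 2 (Matrix.of fun i j : Fin 2 => if i.val + j.val + 1 = 2 then (1 : L) else 0)).Local v × (UnitaryGroup.cmDatum L 1 (Matrix.of fun i j : Fin 1 => if i.val + j.val + 1 = 1 then (1 : L) else 0)).Local v) ⧸ Subgroup.centralizer ({a} : Set ((UnitaryGroup.cmDatum L 2 (Matrix.of fun i j : Fin 2 => if i.val + j.val + 1 = 2 then (1 : L) else 0)).Local v × (UnitaryGroup.cmDatum L 1 (Matrix.of fun i j : Fin 1 => if i.val + j.val + 1 = 1 then (1 : L) else 0)).Local v)))]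
      [∀ a : ((UnitaryGroup.cmDatum L 2 (Matrix.of fun i j : Fin 2 => if i.val + j.val + 1 = 2 then (1 : L) else 0)).Local v × (UnitaryGroup.cmDatum L 1 (Matrix.of fun i j : Fin 1 => if i.val + j.val + 1 = 1 then (1 : L) else 0)).Local v),
        BorelSpace (((UnitaryGroup.cmDatum L 2 (Matrix.of fun i j : Fin 2 => if i.val + j.val + 1 = 2 then (1 : L) else 0)).Local v × (UnitaryGroup.cmDatum L 1 (Matrix.of fun i j : Fin 1 => if i.val + j.val + 1 = 1 then (1 : L) else 0)).Local v) ⧸ Subgroup.centralizer ({a} : Set ((UnitaryGroup.cmDatum L 2 (Matrix.of fun i j : Fin 2 => if i.val + j.val + 1 = 2 then (1 : L) else 0)).Local v × (UnitaryGroup.cmDatum L 1 (Matrix.of fun i j : Fin 1 => if i.val + j.val + 1 = 1 then (1 : L) else 0)).Local v)))]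
      [MeasurableSpace ((UnitaryGroup.cmDatum L 3 H').Local v)] [BorelSpace ((UnitaryGroup.cmDatum L 3 H').Local v)]
      [∀ γ : ((UnitaryGroup.cmDatum L 3 H').Local v), MeasurableSpace (((UnitaryGroup.cmDatum L 3 H').Local v) ⧸ Subgroup.centralizer ({γ} : Set ((UnitaryGroup.cmDatum L 3 H').Local v)))]
      [∀ γ : ((UnitaryGroup.cmDatum L 3 H').Local v), BorelSpace (((UnitaryGroup.cmDatum L 3 H').Local v) ⧸ Subgroup.centralizer ({γ} : Set ((UnitaryGroup.cmDatum L 3 H').Local v)))]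
      (νHv : Measure ((UnitaryGroup.cmDatum L 2 (Matrix.of fun i j : Fin 2 => if i.val + j.val + 1 = 2 then (1 : L) else 0)).Local v × (UnitaryGroup.cmDatum L 1 (Matrix.of fun i j : Fin 1 => if i.val + j.val + 1 = 1 then (1 : L) else 0)).Local v)) (νGv : Measure ((UnitaryGroup.cmDatum L 3 H').Local v))
      [νHv.IsHaarMeasure] [νHv.IsMulRightInvariant] [νGv.IsHaarMeasure] [νGv.IsMulRightInvariant]
      (mHv : OrbitalMeasureFamily ((UnitaryGroup.cmDatum L 2 (Matrix.of fun i j : Fin 2 => if i.val + j.val + 1 = 2 then (1 : L) else 0)).Local v × (UnitaryGroup.cmDatum L 1 (Matrix.of fun i j : Fin 1 => if i.val + j.val + 1 = 1 then (1 : L) else 0)).Local v)) (mGv : OrbitalMeasureFamily ((UnitaryGroup.cmDatum L 3 H').Local v)),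
      mHv.IsCanonical (IsLocalGRegular L v) νHv →
      mGv.IsCanonical (fun γ : ((UnitaryGroup.cmDatum L 3 H').Local v) => IsRegularElt (γ.val : GL (Fin 3) (UnitaryGroup.LocalRing L v))) νGv →
    ∀ (μ : HeckeCharacter L), μ.IsUnitary →
      (∀ x : ideleGroup ↥(maximalRealSubfield L), μ (AdeleRing.ideleBaseChange (↥(maximalRealSubfield L)) L x) = quadraticHeckeCharCM L x) →
    ∀ (γH : (UnitaryGroup.cmDatum L 2 (Matrix.of fun i j : Fin 2 => if i.val + j.val + 1 = 2 then (1 : L) else 0)).Rational × (UnitaryGroup.cmDatum L 1 (Matrix.of fun i j : Fin 1 => if i.val + j.val + 1 = 1 then (1 : L) else 0)).Rational) (e₁ e₂ : L), e₁ ≠ e₂ →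
      (((γH.1 : unitaryGroup (cmConjRingHom L) (Matrix.of fun i j : Fin 2 => if i.val + j.val + 1 = 2 then (1 : L) else 0)).val : GL (Fin 2) L) : Matrix (Fin 2) (Fin 2) L) = e₁ • (1 : Matrix (Fin 2) (Fin 2) L) →
      (((γH.2 : unitaryGroup (cmConjRingHom L) (Matrix.of fun i j : Fin 1 => if i.val + j.val + 1 = 1 then (1 : L) else 0)).val : GL (Fin 1) L) : Matrix (Fin 1) (Fin 1) L) 0 0 = e₂ →
    ∃ (γ : ℕ → ((UnitaryGroup.cmDatum L 2 (Matrix.of fun i j : Fin 2 => if i.val + j.val + 1 = 2 then (1 : L) else 0)).Local v × (UnitaryGroup.cmDatum L 1 (Matrix.of fun i j : Fin 1 => if i.val + j.val + 1 = 1 then (1 : L) else 0)).Local v)) (G : ℕ → ℂ) (lam lam' : ℂ),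
      (∀ n, IsLocalGRegular L v (γ n)) ∧
      Tendsto γ atTop (nhds
        ((UnitaryGroup.cmDatum L 2 (Matrix.of fun i j : Fin 2 => if i.val + j.val + 1 = 2 then (1 : L) else 0)).toLocal v ((UnitaryGroup.cmDatum L 2 (Matrix.of fun i j : Fin 2 => if i.val + j.val + 1 = 2 then (1 : L) else 0)).toAdelic γH.1),
          (UnitaryGroup.cmDatum L 1 (Matrix.of fun i j : Fin 1 => if i.val + j.val + 1 = 1 then (1 : L) else 0)).toLocal v ((UnitaryGroup.cmDatum L 1 (Matrix.of fun i j : Fin 1 => if i.val + j.val + 1 = 1 then (1 : L) else 0)).toAdelic γH.2))) ∧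
      (Set.range G).Infinite ∧ lam ≠ 0 ∧
      (∀ φ : ((UnitaryGroup.cmDatum L 2 (Matrix.of fun i j : Fin 2 => if i.val + j.val + 1 = 2 then (1 : L) else 0)).Local v × (UnitaryGroup.cmDatum L 1 (Matrix.of fun i j : Fin 1 => if i.val + j.val + 1 = 1 then (1 : L) else 0)).Local v) → ℂ, IsLocSmooth φ →
        ∃ a b : ℂ, (∀ᶠ n in atTop, stableOrbitalIntegralRel (IsLocalStablyConjH L v) mHv φ (γ n) = a + b * G n) ∧
          φ ((UnitaryGroup.cmDatum L 2 (Matrix.of fun i j : Fin 2 => if i.val + j.val + 1 = 2 then (1 : L) else 0)).toLocal v ((UnitaryGroup.cmDatum L 2 (Matrix.of fun i j : Fin 2 => if i.val + j.val + 1 = 2 then (1 : L) else 0)).toAdelic γH.1),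
          (UnitaryGroup.cmDatum L 1 (Matrix.of fun i j : Fin 1 => if i.val + j.val + 1 = 1 then (1 : L) else 0)).toLocal v ((UnitaryGroup.cmDatum L 1 (Matrix.of fun i j : Fin 1 => if i.val + j.val + 1 = 1 then (1 : L) else 0)).toAdelic γH.2)) = lam * a + lam' * b) ∧
      (∃ (φ₁ φ₂ : ((UnitaryGroup.cmDatum L 2 (Matrix.of fun i j : Fin 2 => if i.val + j.val + 1 = 2 then (1 : L) else 0)).Local v × (UnitaryGroup.cmDatum L 1 (Matrix.of fun i j : Fin 1 => if i.val + j.val + 1 = 1 then (1 : L) else 0)).Local v) → ℂ) (a₁ b₁ a₂ b₂ : ℂ), IsLocSmooth φ₁ ∧ IsLocSmooth φ₂ ∧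
        (∀ᶠ n in atTop, stableOrbitalIntegralRel (IsLocalStablyConjH L v) mHv φ₁ (γ n) = a₁ + b₁ * G n) ∧
        (∀ᶠ n in atTop, stableOrbitalIntegralRel (IsLocalStablyConjH L v) mHv φ₂ (γ n) = a₂ + b₂ * G n) ∧ a₁ * b₂ - a₂ * b₁ ≠ 0) ∧
      (∃ (f₁ f₂ : (UnitaryGroup.cmDatum L 3 H').Local v → ℂ) (fH'₁ fH'₂ : ((UnitaryGroup.cmDatum L 2 (Matrix.of fun i j : Fin 2 => if i.val + j.val + 1 = 2 then (1 : L) else 0)).Local v ×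
          (UnitaryGroup.cmDatum L 1 (Matrix.of fun i j : Fin 1 => if i.val + j.val + 1 = 1 then (1 : L) else 0)).Local v) → ℂ) (a'₁ b'₁ a'₂ b'₂ : ℂ),
        IsLocSmooth f₁ ∧ IsLocSmooth f₂ ∧ IsLocSmooth fH'₁ ∧ IsLocSmooth fH'₂ ∧
        IsLocalDeltaTransfer L H' v (finExplicitCollection L H' μ (finExplicitDelta_conj_left_all L H' μ) (finExplicitDelta_conj_right_all L H' μ) v) mHv mGv fH'₁ f₁ ∧
        IsLocalDeltaTransfer L H' v (finExplicitCollection L H' μ (finExplicitDelta_conj_left_all L H' μ) (finExplicitDelta_conj_right_all L H' μ) v) mHv mGv fH'₂ f₂ ∧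
        (∀ᶠ n in atTop, stableOrbitalIntegralRel (IsLocalStablyConjH L v) mHv fH'₁ (γ n) = a'₁ + b'₁ * G n) ∧
        (∀ᶠ n in atTop, stableOrbitalIntegralRel (IsLocalStablyConjH L v) mHv fH'₂ (γ n) = a'₂ + b'₂ * G n) ∧ a'₁ * b'₂ - a'₂ * b'₁ ≠ 0) := by
  intro L _ _ _ H' hherm hanis v hns _ _ _ _ _ _ _ _ νHv νGv _ _ _ _ mHv mGv hcanH hcanG μ hμu hμω γH e₁ e₂ hne hγH₁ hγH₂
  classical
  -- (1) a split witness `w ∣ v`, the shell kit (★ T⁺ fed by ★ GS^P⁺), the frame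
  obtain ⟨w, hw⟩ := K2E4ExplicitSplitConstantPhase.exists_smul_ne_of_not_subsingleton L v hns
  obtain ⟨γ, G, lam, lam', hreg, hlim, hG, hlam, hGS, y, Y, hyconj, hY1, hY2, hylim, hcrit⟩ :=
    K2E3CentralGermShellKitSplit.centralGermShellKit_split
      (fun ν _ _ z c => K2E3GLTwoCentralGermShellKit.exists_ellipticRay_orbitalIntegral_eq_add_mul_shellKit ν z c)
      L v w hw νHv mHv hcanH γH e₁ hγH₁
  have hH'd : IsUnit H'.det := isUnit_iff_ne_zero.mpr (Godement.det_ne_zero_of_anisotropic L H' hanis)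
  letI : MeasurableSpace (w.1.adicCompletion L) := borel _
  haveI : BorelSpace (w.1.adicCompletion L) := ⟨rfl⟩
  letI : MeasurableSpace (GL (Fin 3) (w.1.adicCompletion L)) := borel _
  haveI : BorelSpace (GL (Fin 3) (w.1.adicCompletion L)) := ⟨rfl⟩
  haveI : LocallyCompactSpace (GL (Fin 3) (w.1.adicCompletion L)) := UnitaryGroup.locallyCompactSpace_gl_adicCompletion L 3 w.1
  haveI : SecondCountableTopology (GL (Fin 3) (w.1.adicCompletion L)) := UnitaryGroup.secondCountableTopology_gl_adicCompletion L 3 w.1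
  haveI : BorelSpace ↥(glInt 3 (w.1.adicCompletion L)) := Subtype.borelSpace _
  haveI : CompactSpace ↥(glInt 3 (w.1.adicCompletion L)) := isCompact_iff_compactSpace.1 (isCompact_glInt 3 (w.1.adicCompletion L))
  have hUc : IsClosed (unipotentRadicalGL (w.1.adicCompletion L) (Zelevinsky1980.lastBlockLabel 3) : Set (GL (Fin 3) (w.1.adicCompletion L))) :=
    isClosed_unipotentRadicalGL (R := (w.1.adicCompletion L)) (Zelevinsky1980.lastBlockLabel 3)
  haveI : BorelSpace ↥(unipotentRadicalGL (w.1.adicCompletion L) (Zelevinsky1980.lastBlockLabel 3)) := Subtype.borelSpace _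
  haveI : LocallyCompactSpace ↥(unipotentRadicalGL (w.1.adicCompletion L) (Zelevinsky1980.lastBlockLabel 3)) :=
    hUc.isClosedEmbedding_subtypeVal.locallyCompactSpace
  haveI : SecondCountableTopology ↥(unipotentRadicalGL (w.1.adicCompletion L) (Zelevinsky1980.lastBlockLabel 3)) :=
    TopologicalSpace.Subtype.secondCountableTopology _
  obtain ⟨κ, hκ⟩ : ∃ κ : Measure ↥(glInt 3 (w.1.adicCompletion L)), κ = haarMeasure (UnitaryGroup.glIntPositiveCompacts (w.1.adicCompletion L)) := ⟨_, rfl⟩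
  haveI : IsHaarMeasure κ := by rw [hκ]; exact isHaarMeasure_haarMeasure _
  obtain ⟨μU, hμU⟩ : ∃ μU : Measure ↥(unipotentRadicalGL (w.1.adicCompletion L) (Zelevinsky1980.lastBlockLabel 3)),
      μU = haarMeasure (UnitaryGroup.unipotentIntPositiveCompacts (w.1.adicCompletion L)) := ⟨_, rfl⟩
  haveI : IsHaarMeasure μU := by rw [hμU]; exact isHaarMeasure_haarMeasure _
  haveI : SFinite μU := inferInstance
  have hKU : UnitaryGroup.splitKUMeasure (w.1.adicCompletion L) = κ.prod μU := by rw [hκ, hμU]; rfl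
  have hκ1 : κ Set.univ = 1 := by rw [hκ]; exact haarMeasure_self
  set e' := UnitaryGroup.localSplitEquiv (IsCMField.complexConj L) H' (IsCMField.complexConj_ne_one L)
      ((UnitaryGroup.map_cmConjRingHom_eq_map_complexConj L H') ▸ hherm) w hw (UnitaryGroup.isUnit_placeForm_of_isUnit_det hH'd w.1) with he'
  -- the named transfer of a smooth `f` is a smooth `Δ‴_v`-transfer pair (★ Lemma 4.13.1 (a) BY NAME)
  have hΦ₂d : (Matrix.of fun i j : Fin 2 => if i.val + j.val + 1 = 2 then (1 : L) else 0).det ≠ 0 := (UnitaryGroup.isUnit_antidiagOne_det L 2).ne_zero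
  have hΦ₁d : (Matrix.of fun i j : Fin 1 => if i.val + j.val + 1 = 1 then (1 : L) else 0).det ≠ 0 := (UnitaryGroup.isUnit_antidiagOne_det L 1).ne_zero
  have htr : ∀ f : ((UnitaryGroup.cmDatum L 3 H').Local v) → ℂ, IsLocSmooth f →
      IsLocSmooth (UnitaryGroup.cmSplitTransfer L H' hherm hH'd v w hw μ νHv νGv f) ∧
        IsLocalDeltaTransfer L H' v (finExplicitCollection L H' μ (finExplicitDelta_conj_left_all L H' μ) (finExplicitDelta_conj_right_all L H' μ) v) mHv mGv
          (UnitaryGroup.cmSplitTransfer L H' hherm hH'd v w hw μ νHv νGv f) f := fun f hf =>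
    isLocalDeltaTransfer_cmSplitTransfer L H' (IsCMField.complexConj_ne_one L) w hw
      (UnitaryGroup.antidiagOne_map_transpose (IsCMField.complexConj L) 2) (UnitaryGroup.isUnit_placeForm_antidiagOne (E := L) 2 w.1)
      (UnitaryGroup.antidiagOne_map_transpose (IsCMField.complexConj L) 1) (UnitaryGroup.isUnit_placeForm_antidiagOne (E := L) 1 w.1)
      ((UnitaryGroup.map_cmConjRingHom_eq_map_complexConj L H') ▸ hherm) (UnitaryGroup.isUnit_placeForm_of_isUnit_det hH'd w.1)
      (UnitaryGroup.antidiagOne_isHermitian L 2) hΦ₂d (UnitaryGroup.antidiagOne_isHermitian L 1) hΦ₁d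
      μ (finExplicitDelta_conj_left_all L H' μ) (finExplicitDelta_conj_right_all L H' μ)
      (HeckeCharacter.galConj_eq_inv_of_restrict_eq_quadraticHeckeCharCM L μ hμω) νHv νGv mHv mGv hcanH hcanG hherm hH'd f hf
  -- (2) the centre, its Levi image `m₀ = diag(e₁, e₁, e₂)`, the limit `y_G = m(Y)` of the deepest shells, the cone `Z`
  set z' : (w.1.adicCompletion L) := algebraMap L (w.1.adicCompletion L) e₁ with hz'
  set c' : (w.1.adicCompletion L) := algebraMap L (w.1.adicCompletion L) e₂ with hc'
  have hzc : z' ≠ c' := fun h => hne ((algebraMap L (w.1.adicCompletion L)).injective h)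
  have he₁ : e₁ ≠ 0 := by
    intro h0
    have hu := Matrix.isUnits_det_units ((γH.1 : unitaryGroup (cmConjRingHom L) (Matrix.of fun i j : Fin 2 => if i.val + j.val + 1 = 2 then (1 : L) else 0)).val)
    rw [hγH₁, h0, zero_smul, Matrix.det_zero] at hu
    exact not_isUnit_zero hu
  have hz0 : z' ≠ 0 := (map_ne_zero_iff _ (algebraMap L (w.1.adicCompletion L)).injective).2 he₁
  have hcentre₁ : ((UnitaryGroup.cmSplitEquivTwo L v w hw ((UnitaryGroup.cmDatum L 2 (Matrix.of fun i j : Fin 2 => if i.val + j.val + 1 = 2 then (1 : L) else 0)).toLocal v ((UnitaryGroup.cmDatum L 2 (Matrix.of fun i j : Fin 2 => if i.val + j.val + 1 = 2 then (1 : L) else 0)).toAdelic γH.1)) : GL (Fin 2) (w.1.adicCompletion L)) : Matrix (Fin 2) (Fin 2) (w.1.adicCompletion L)) = z' • (1 : Matrix (Fin 2) (Fin 2) (w.1.adicCompletion L)) := by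
    change ((((UnitaryGroup.cmDatum L 2 (Matrix.of fun i j : Fin 2 => if i.val + j.val + 1 = 2 then (1 : L) else 0)).toLocal v ((UnitaryGroup.cmDatum L 2 (Matrix.of fun i j : Fin 2 => if i.val + j.val + 1 = 2 then (1 : L) else 0)).toAdelic γH.1)).val : GL (Fin 2) (UnitaryGroup.LocalRing L v)).val : Matrix (Fin 2) (Fin 2) (UnitaryGroup.LocalRing L v)).map
        (Pi.evalRingHom (fun w : UnitaryGroup.PlacesOver L v => w.1.adicCompletion L) w) = z' • (1 : Matrix (Fin 2) (Fin 2) (w.1.adicCompletion L))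
    rw [K2E4ExplicitSplitConstantPhase.coe_fst_local_eq_smul_one L v γH hγH₁, Matrix.map_smul' _ _ _ (map_mul _), Matrix.map_one _ (map_zero _) (map_one _)]
    rfl
  have hcentre₂ : ((UnitaryGroup.cmSplitEquivOne L v w hw ((UnitaryGroup.cmDatum L 1 (Matrix.of fun i j : Fin 1 => if i.val + j.val + 1 = 1 then (1 : L) else 0)).toLocal v ((UnitaryGroup.cmDatum L 1 (Matrix.of fun i j : Fin 1 => if i.val + j.val + 1 = 1 then (1 : L) else 0)).toAdelic γH.2)) : GL (Fin 1) (w.1.adicCompletion L)) : Matrix (Fin 1) (Fin 1) (w.1.adicCompletion L)) 0 0 = c' := by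
    change (((((UnitaryGroup.cmDatum L 1 (Matrix.of fun i j : Fin 1 => if i.val + j.val + 1 = 1 then (1 : L) else 0)).toLocal v ((UnitaryGroup.cmDatum L 1 (Matrix.of fun i j : Fin 1 => if i.val + j.val + 1 = 1 then (1 : L) else 0)).toAdelic γH.2)).val : GL (Fin 1) (UnitaryGroup.LocalRing L v)).val : Matrix (Fin 1) (Fin 1) (UnitaryGroup.LocalRing L v)).map
        (Pi.evalRingHom (fun w : UnitaryGroup.PlacesOver L v => w.1.adicCompletion L) w)) 0 0 = c'
    rw [coe_toLocal_toAdelic_eq_map, Matrix.map_apply, Matrix.map_apply, hγH₂]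
    rfl
  have hm₀ : ((UnitaryGroup.cmSplitLeviGL L v w hw (((UnitaryGroup.cmDatum L 2 (Matrix.of fun i j : Fin 2 => if i.val + j.val + 1 = 2 then (1 : L) else 0)).toLocal v ((UnitaryGroup.cmDatum L 2 (Matrix.of fun i j : Fin 2 => if i.val + j.val + 1 = 2 then (1 : L) else 0)).toAdelic γH.1)), ((UnitaryGroup.cmDatum L 1 (Matrix.of fun i j : Fin 1 => if i.val + j.val + 1 = 1 then (1 : L) else 0)).toLocal v ((UnitaryGroup.cmDatum L 1 (Matrix.of fun i j : Fin 1 => if i.val + j.val + 1 = 1 then (1 : L) else 0)).toAdelic γH.2))) : GL (Fin 3) (w.1.adicCompletion L)) : Matrix (Fin 3) (Fin 3) (w.1.adicCompletion L)) = !![z', 0, 0; 0, z', 0; 0, 0, c'] := by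
    rw [UnitaryGroup.cmSplitLeviGL_apply, UnitaryGroup.coe_reindexGL, UnitaryGroup.coe_blockDiagGL, K2E4SplitTransferConeAlgebra.reindex_fromBlocks_two_one]
    simp only [hcentre₁, hcentre₂, Matrix.smul_apply, Matrix.one_apply_eq, Matrix.one_apply_ne (show (0 : Fin 2) ≠ 1 by decide),
      Matrix.one_apply_ne (show (1 : Fin 2) ≠ 0 by decide), smul_eq_mul, mul_one, mul_zero]
  have hY2' : ((UnitaryGroup.cmSplitEquivOne L v w hw Y.2 : GL (Fin 1) (w.1.adicCompletion L)) : Matrix (Fin 1) (Fin 1) (w.1.adicCompletion L)) 0 0 = c' := by rw [hY2, hcentre₂]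
  have hyG : ((UnitaryGroup.cmSplitLeviGL L v w hw Y : GL (Fin 3) (w.1.adicCompletion L)) : Matrix (Fin 3) (Fin 3) (w.1.adicCompletion L)) = !![z', 0, 0; z', z', 0; 0, 0, c'] := by
    rw [UnitaryGroup.cmSplitLeviGL_apply, UnitaryGroup.coe_reindexGL, UnitaryGroup.coe_blockDiagGL, K2E4SplitTransferConeAlgebra.reindex_fromBlocks_two_one, hY1, hY2']
    simp
  -- the cone `Z` (closed), `y_G ∉ Z`, every `k (m₀ u) k⁻¹ ∈ Z`
  set Z : Set (GL (Fin 3) (w.1.adicCompletion L)) := {g | ((g : Matrix (Fin 3) (Fin 3) (w.1.adicCompletion L)) - z' • (1 : Matrix (Fin 3) (Fin 3) (w.1.adicCompletion L))) *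
      ((g : Matrix (Fin 3) (Fin 3) (w.1.adicCompletion L)) - c' • (1 : Matrix (Fin 3) (Fin 3) (w.1.adicCompletion L))) = 0} with hZ
  have hZc : IsClosed Z :=
    isClosed_eq ((Units.continuous_val.sub continuous_const).mul (Units.continuous_val.sub continuous_const)) continuous_const
  have hyGZ : UnitaryGroup.cmSplitLeviGL L v w hw Y ∉ Z := by
    rw [hZ, Set.mem_setOf_eq]
    exact K2E4SplitTransferConeAlgebra.shell_not_cone hz0 hzc hyG
  have hconeZ : ∀ (k : GL (Fin 3) (w.1.adicCompletion L)) (u : GL (Fin 3) (w.1.adicCompletion L)), u ∈ unipotentRadicalGL (w.1.adicCompletion L) (Zelevinsky1980.lastBlockLabel 3) →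
      k * (UnitaryGroup.cmSplitLeviGL L v w hw (((UnitaryGroup.cmDatum L 2 (Matrix.of fun i j : Fin 2 => if i.val + j.val + 1 = 2 then (1 : L) else 0)).toLocal v ((UnitaryGroup.cmDatum L 2 (Matrix.of fun i j : Fin 2 => if i.val + j.val + 1 = 2 then (1 : L) else 0)).toAdelic γH.1)), ((UnitaryGroup.cmDatum L 1 (Matrix.of fun i j : Fin 1 => if i.val + j.val + 1 = 1 then (1 : L) else 0)).toLocal v ((UnitaryGroup.cmDatum L 1 (Matrix.of fun i j : Fin 1 => if i.val + j.val + 1 = 1 then (1 : L) else 0)).toAdelic γH.2))) * u) * k⁻¹ ∈ Z := fun k u hu => by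
    rw [hZ, Set.mem_setOf_eq, Units.val_mul, Units.val_mul, Units.val_mul,
      K2E4SplitTransferConeAlgebra.cone_conj z' c' _ _ _ (Units.mul_inv k) (Units.inv_mul k)]
    obtain ⟨h00, h01, h10, h11, h20, h21, h22⟩ := K2E4SplitTransferConeAlgebra.unipotent_apply_eq (u : Matrix (Fin 3) (Fin 3) (w.1.adicCompletion L))
      ((mem_unipotentRadicalGL_iff_apply u).1 hu)
    rw [K2E4SplitTransferConeAlgebra.cone_diag_mul_unipotent z' c' hm₀ h00 h01 h10 h11 h20 h21 h22, Matrix.mul_zero, Matrix.zero_mul]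
  -- (3) a compact open neighbourhood `D = y_G·K(ϖ^N)` of `y_G` disjoint from `Z`
  have hU₀ : {k : GL (Fin 3) (w.1.adicCompletion L) | UnitaryGroup.cmSplitLeviGL L v w hw Y * k ∈ Zᶜ} ∈ 𝓝 (1 : GL (Fin 3) (w.1.adicCompletion L)) :=
    (hZc.isOpen_compl.preimage (continuous_const_mul _)).mem_nhds (by rw [Set.mem_preimage, mul_one]; exact hyGZ)
  obtain ⟨ϖ, hϖ⟩ := exists_isUniformizingElement (F := (w.1.adicCompletion L))
  obtain ⟨N, -, hNU⟩ := exists_congruenceGL_pow_subset hϖ hU₀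
  have hvN0 : ValuativeRel.valuation (w.1.adicCompletion L) ϖ ^ N ≠ 0 := pow_ne_zero _ ((Valuation.ne_zero_iff _).2 hϖ.ne_zero)
  set D : Set (GL (Fin 3) (w.1.adicCompletion L)) := (fun g => (UnitaryGroup.cmSplitLeviGL L v w hw Y)⁻¹ * g) ⁻¹'
      (congruenceGL 3 (ValuativeRel.valuation (w.1.adicCompletion L) ϖ ^ N) : Set (GL (Fin 3) (w.1.adicCompletion L))) with hD
  have hDo : IsOpen D := (isOpen_congruenceGL (n := 3) hvN0).preimage (continuous_const_mul _)
  have hDcl : IsClosed D := (isClosed_congruenceGL (n := 3) _).preimage (continuous_const_mul _)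
  have hDc : IsCompact D :=
    (Homeomorph.isCompact_preimage (Homeomorph.mulLeft (UnitaryGroup.cmSplitLeviGL L v w hw Y)⁻¹)).2 (isCompact_congruenceGL (n := 3) _)
  have hyGD : UnitaryGroup.cmSplitLeviGL L v w hw Y ∈ D := by
    rw [hD, Set.mem_preimage, inv_mul_cancel]; exact Subgroup.one_mem _
  have hDZ : ∀ g ∈ D, g ∉ Z := fun g hg hgZ => by
    have h := hNU hg
    rw [Set.mem_setOf_eq, mul_inv_cancel_left] at h
    exact h hgZ
  -- (4) the two test functions and their transfers
  obtain ⟨f₁, hf₁, hval₁⟩ := K2E3GermConstantRegularHRSplit.exists_isLocSmooth_cmSplitTransfer_apply_ne_zero L H' hherm hH'd v w hw νHv νGv μ (((UnitaryGroup.cmDatum L 2 (Matrix.of fun i j : Fin 2 => if i.val + j.val + 1 = 2 then (1 : L) else 0)).toLocal v ((UnitaryGroup.cmDatum L 2 (Matrix.of fun i j : Fin 2 => if i.val + j.val + 1 = 2 then (1 : L) else 0)).toAdelic γH.1)), ((UnitaryGroup.cmDatum L 1 (Matrix.of fun i j : Fin 1 => if i.val + j.val + 1 = 1 then (1 : L)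 else 0)).toLocal v ((UnitaryGroup.cmDatum L 1 (Matrix.of fun i j : Fin 1 => if i.val + j.val + 1 = 1 then (1 : L) else 0)).toAdelic γH.2)))
  obtain ⟨f₂, hf₂def⟩ : ∃ f : ((UnitaryGroup.cmDatum L 3 H').Local v) → ℂ, f = (e' ⁻¹' D).indicator (fun _ => (1 : ℂ)) := ⟨_, rfl⟩
  have hf₂ : IsLocSmooth f₂ := by
    rw [hf₂def]
    exact isLocSmooth_indicator (hDo.preimage e'.continuous) (hDcl.preimage e'.continuous) (e'.toHomeomorph.isCompact_preimage.2 hDc)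
  obtain ⟨hs₁, htr₁⟩ := htr f₁ hf₁
  obtain ⟨hs₂, htr₂⟩ := htr f₂ hf₂
  -- (5) the value of `τ_v·f̄₂^P` at `h`: phase × `δ^{1∕2}(m_h)` × the `κ⊗μ_U`-mass of `S_h = {(k,u) : k m_h u k⁻¹ ∈ D}`
  set S : ((UnitaryGroup.cmDatum L 2 (Matrix.of fun i j : Fin 2 => if i.val + j.val + 1 = 2 then (1 : L) else 0)).Local v × (UnitaryGroup.cmDatum L 1 (Matrix.of fun i j : Fin 1 => if i.val + j.val + 1 = 1 then (1 : L) else 0)).Local v) → Set (↥(glInt 3 (w.1.adicCompletion L)) × ↥(unipotentRadicalGL (w.1.adicCompletion L) (Zelevinsky1980.lastBlockLabel 3))) := fun h =>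
    {q | (q.1 : GL (Fin 3) (w.1.adicCompletion L)) * (UnitaryGroup.cmSplitLeviGL L v w hw h * (q.2 : GL (Fin 3) (w.1.adicCompletion L))) * (q.1 : GL (Fin 3) (w.1.adicCompletion L))⁻¹ ∈ D} with hS
  have hSo : ∀ h, IsOpen (S h) := fun h =>
    hDo.preimage (((continuous_subtype_val.comp continuous_fst).mul
      (continuous_const.mul (continuous_subtype_val.comp continuous_snd))).mul ((continuous_subtype_val.comp continuous_fst).inv))
  have hval : ∀ h : ((UnitaryGroup.cmDatum L 2 (Matrix.of fun i j : Fin 2 => if i.val + j.val + 1 = 2 then (1 : L) else 0)).Local v × (UnitaryGroup.cmDatum L 1 (Matrix.of fun i j : Fin 1 => if i.val + j.val + 1 = 1 then (1 : L) else 0)).Local v), UnitaryGroup.cmSplitTransfer L H' hherm hH'd v w hw μ νHv νGv f₂ h =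
      (((νGv (UnitaryGroup.cmSplitMaxCompact L v w hw H' hherm hH'd)).toReal / (νHv (UnitaryGroup.cmSplitLeviCompact L v w hw)).toReal : ℝ) : ℂ) *
        ((μ.localComponent w.1 (Matrix.GeneralLinearGroup.det (UnitaryGroup.cmSplitEquivTwo L v w hw h.1)) : ℂˣ) : ℂ) *
        (((rootDeltaChar (standardParabolicGL (w.1.adicCompletion L) (Zelevinsky1980.lastBlockLabel 3))
            ⟨UnitaryGroup.cmSplitLeviGL L v w hw h, UnitaryGroup.cmSplitLeviGL_mem_standardParabolicGL L v w hw h⟩ : ℂˣ) : ℂ) *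
          (((κ.prod μU).real (S h) : ℝ) : ℂ)) := fun h => by
    rw [UnitaryGroup.cmSplitTransfer_apply, UnitaryGroup.cmConstantTermSplit_apply]
    have hint : (fun q : ↥(glInt 3 (w.1.adicCompletion L)) × ↥(unipotentRadicalGL (w.1.adicCompletion L) (Zelevinsky1980.lastBlockLabel 3)) =>
        f₂ (e'.symm ((q.1 : GL (Fin 3) (w.1.adicCompletion L)) * (UnitaryGroup.cmSplitLeviGL L v w hw h * (q.2 : GL (Fin 3) (w.1.adicCompletion L))) * (q.1 : GL (Fin 3) (w.1.adicCompletion L))⁻¹))) =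
        (S h).indicator (fun _ => (1 : ℂ)) := by
      funext q
      simp only [hf₂def, hS, Set.indicator_apply, Set.mem_preimage, Set.mem_setOf_eq, ContinuousMulEquiv.apply_symm_apply]
    rw [hKU, hint, integral_indicator_const _ (hSo h).measurableSet, Complex.real_smul, mul_one]
  -- (5a) at the centre the mass set is EMPTY (the integrand lives on the cone): `fH′₂((γ_H)_v) = 0`
  have hφ₂z : UnitaryGroup.cmSplitTransfer L H' hherm hH'd v w hw μ νHv νGv f₂ (((UnitaryGroup.cmDatum L 2 (Matrix.of fun i j : Fin 2 => if i.val + j.val + 1 = 2 then (1 : L) else 0)).toLocal v ((UnitaryGroup.cmDatum L 2 (Matrix.of fun i j : Fin 2 => if i.val + j.val + 1 = 2 then (1 : L) else 0)).toAdelic γH.1)), ((UnitaryGroup.cmDatum L 1 (Matrix.of fun i j : Fin 1 => if i.val + j.val + 1 = 1 then (1 : L) else 0)).toLocal v ((UnitaryGroup.cmDatum L 1 (Matrix.of fun i j : Fin 1 => if i.val + j.val + 1 = 1 then (1 : L) else 0)).toAdelic γH.2))) = 0 := by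
    have hempty : S (((UnitaryGroup.cmDatum L 2 (Matrix.of fun i j : Fin 2 => if i.val + j.val + 1 = 2 then (1 : L) else 0)).toLocal v ((UnitaryGroup.cmDatum L 2 (Matrix.of fun i j : Fin 2 => if i.val + j.val + 1 = 2 then (1 : L) else 0)).toAdelic γH.1)), ((UnitaryGroup.cmDatum L 1 (Matrix.of fun i j : Fin 1 => if i.val + j.val + 1 = 1 then (1 : L) else 0)).toLocal v ((UnitaryGroup.cmDatum L 1 (Matrix.of fun i j : Fin 1 => if i.val + j.val + 1 = 1 then (1 : L) else 0)).toAdelic γH.2))) = ∅ := Set.eq_empty_iff_forall_notMem.2 fun q hq =>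
      hDZ _ hq (hconeZ _ _ q.2.2)
    rw [hval, hempty, measureReal_empty, Complex.ofReal_zero, mul_zero, mul_zero]
  -- (5b) phase coherence on the conjugates of `γ_n` (the two characters are constant on conjugacy classes)
  set χδ : ((UnitaryGroup.cmDatum L 2 (Matrix.of fun i j : Fin 2 => if i.val + j.val + 1 = 2 then (1 : L) else 0)).Local v × (UnitaryGroup.cmDatum L 1 (Matrix.of fun i j : Fin 1 => if i.val + j.val + 1 = 1 then (1 : L) else 0)).Local v) →* ℂˣ := (rootDeltaChar (standardParabolicGL (w.1.adicCompletion L) (Zelevinsky1980.lastBlockLabel 3))).comp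
    ((UnitaryGroup.cmSplitLeviGL L v w hw).codRestrict _ (UnitaryGroup.cmSplitLeviGL_mem_standardParabolicGL L v w hw)) with hχδ
  have hχδ_apply : ∀ h : ((UnitaryGroup.cmDatum L 2 (Matrix.of fun i j : Fin 2 => if i.val + j.val + 1 = 2 then (1 : L) else 0)).Local v × (UnitaryGroup.cmDatum L 1 (Matrix.of fun i j : Fin 1 => if i.val + j.val + 1 = 1 then (1 : L) else 0)).Local v), ((rootDeltaChar (standardParabolicGL (w.1.adicCompletion L) (Zelevinsky1980.lastBlockLabel 3))
      ⟨UnitaryGroup.cmSplitLeviGL L v w hw h, UnitaryGroup.cmSplitLeviGL_mem_standardParabolicGL L v w hw h⟩ : ℂˣ) : ℂ) = (χδ h : ℂ) := fun _ => rfl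
  have hcoh₂ : ∀ n, ∃ cst : ℂ, cst ≠ 0 ∧ ∀ g : ((UnitaryGroup.cmDatum L 2 (Matrix.of fun i j : Fin 2 => if i.val + j.val + 1 = 2 then (1 : L) else 0)).Local v × (UnitaryGroup.cmDatum L 1 (Matrix.of fun i j : Fin 1 => if i.val + j.val + 1 = 1 then (1 : L) else 0)).Local v), ∃ t : ℝ, 0 ≤ t ∧ UnitaryGroup.cmSplitTransfer L H' hherm hH'd v w hw μ νHv νGv f₂ (g * γ n * g⁻¹) = cst * t := by
    intro n
    refine ⟨(((νGv (UnitaryGroup.cmSplitMaxCompact L v w hw H' hherm hH'd)).toReal / (νHv (UnitaryGroup.cmSplitLeviCompact L v w hw)).toReal : ℝ) : ℂ) *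
        ((μ.localComponent w.1 (Matrix.GeneralLinearGroup.det (UnitaryGroup.cmSplitEquivTwo L v w hw (γ n).1)) : ℂˣ) : ℂ) * (χδ (γ n) : ℂ),
      mul_ne_zero (mul_ne_zero (Complex.ofReal_ne_zero.2 (K2E3GermConstantRegularHRSplit.prefactor_ne_zero L H' hherm hH'd v w hw νHv νGv))
        (Units.ne_zero _)) (Units.ne_zero _), fun g => ⟨(κ.prod μU).real (S (g * γ n * g⁻¹)), measureReal_nonneg, ?_⟩⟩
    rw [hval, hχδ_apply]
    have h1 : Matrix.GeneralLinearGroup.det (UnitaryGroup.cmSplitEquivTwo L v w hw (g * γ n * g⁻¹).1) =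
        Matrix.GeneralLinearGroup.det (UnitaryGroup.cmSplitEquivTwo L v w hw (γ n).1) := by
      simp only [Prod.fst_mul, Prod.fst_inv, map_mul, map_inv, mul_inv_cancel_comm]
    have h2 : χδ (g * γ n * g⁻¹) = χδ (γ n) := by rw [map_mul, map_mul, map_inv, mul_inv_cancel_comm]
    rw [h1, h2]
    ring
  -- (5c) the deepest shells are charged: `m(y_n) ∈ D` for `n ≥ N₁`, and then the mass set of `k y_n k⁻¹` contains `(m_k⁻¹, 1)`
  have hmy : ∀ᶠ n in atTop, UnitaryGroup.cmSplitLeviGL L v w hw (y n) ∈ D :=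
    ((UnitaryGroup.continuous_cmSplitLeviGL L v w hw).tendsto Y |>.comp hylim) (hDo.mem_nhds hyGD)
  obtain ⟨N₁, hN₁⟩ := Filter.eventually_atTop.1 hmy
  have hpos₂ : ∃ N, ∀ n, N ≤ n → ∀ k : ((UnitaryGroup.cmDatum L 2 (Matrix.of fun i j : Fin 2 => if i.val + j.val + 1 = 2 then (1 : L) else 0)).Local v × (UnitaryGroup.cmDatum L 1 (Matrix.of fun i j : Fin 1 => if i.val + j.val + 1 = 1 then (1 : L) else 0)).Local v),
      ((UnitaryGroup.cmSplitEquivTwo L v w hw k.1, UnitaryGroup.cmSplitEquivOne L v w hw k.2) : GL (Fin 2) (w.1.adicCompletion L) × GL (Fin 1) (w.1.adicCompletion L)) ∈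
        (glInt 2 (w.1.adicCompletion L)).prod (glInt 1 (w.1.adicCompletion L)) → UnitaryGroup.cmSplitTransfer L H' hherm hH'd v w hw μ νHv νGv f₂ (k * y n * k⁻¹) ≠ 0 := by
    refine ⟨N₁, fun n hn k hk => ?_⟩
    have hmk : UnitaryGroup.cmSplitLeviGL L v w hw k ∈ glInt 3 (w.1.adicCompletion L) := by
      rw [UnitaryGroup.cmSplitLeviGL_apply]
      exact (reindexGL_finSumFinEquiv_blockDiagGL_mem_glInt_iff _).2 (Subgroup.mem_prod.1 hk)
    -- the mass set is open, non-empty, of finite measure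
    set m := UnitaryGroup.cmSplitLeviGL L v w hw (k * y n * k⁻¹) with hm
    have hq₀ : ((⟨(UnitaryGroup.cmSplitLeviGL L v w hw k)⁻¹, Subgroup.inv_mem _ hmk⟩, 1) :
        ↥(glInt 3 (w.1.adicCompletion L)) × ↥(unipotentRadicalGL (w.1.adicCompletion L) (Zelevinsky1980.lastBlockLabel 3))) ∈ S (k * y n * k⁻¹) := by
      show (UnitaryGroup.cmSplitLeviGL L v w hw k)⁻¹ * (UnitaryGroup.cmSplitLeviGL L v w hw (k * y n * k⁻¹) * ((1 : ↥(unipotentRadicalGL (w.1.adicCompletion L) (Zelevinsky1980.lastBlockLabel 3))) : GL (Fin 3) (w.1.adicCompletion L))) *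
          ((UnitaryGroup.cmSplitLeviGL L v w hw k)⁻¹)⁻¹ ∈ D
      rw [OneMemClass.coe_one, mul_one, map_mul, map_mul, map_inv, inv_inv]
      simpa only [← mul_assoc, inv_mul_cancel, one_mul, inv_mul_cancel_right] using hN₁ n hn
    have hSpos : 0 < (κ.prod μU) (S (k * y n * k⁻¹)) := (hSo _).measure_pos _ ⟨_, hq₀⟩
    -- finiteness: `S ⊆ univ ×ˢ T`, `T` compact
    set E : Set (GL (Fin 3) (w.1.adicCompletion L)) := m⁻¹ • ((glInt 3 (w.1.adicCompletion L) : Set (GL (Fin 3) (w.1.adicCompletion L))) * (D * (glInt 3 (w.1.adicCompletion L) : Set (GL (Fin 3) (w.1.adicCompletion L))))) with hE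
    have hEc : IsCompact E := ((isCompact_glInt 3 (w.1.adicCompletion L)).mul (hDc.mul (isCompact_glInt 3 (w.1.adicCompletion L)))).smul m⁻¹
    set T : Set ↥(unipotentRadicalGL (w.1.adicCompletion L) (Zelevinsky1980.lastBlockLabel 3)) :=
      ((↑) : ↥(unipotentRadicalGL (w.1.adicCompletion L) (Zelevinsky1980.lastBlockLabel 3)) → GL (Fin 3) (w.1.adicCompletion L)) ⁻¹' E with hT
    have hTc : IsCompact T := hUc.isClosedEmbedding_subtypeVal.isCompact_preimage hEc
    have hsub : S (k * y n * k⁻¹) ⊆ (Set.univ : Set ↥(glInt 3 (w.1.adicCompletion L))) ×ˢ T := by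
      intro q hq
      refine Set.mk_mem_prod (Set.mem_univ _) ?_
      rw [hT, Set.mem_preimage, hE, Set.mem_inv_smul_set_iff, smul_eq_mul]
      refine ⟨(q.1 : GL (Fin 3) (w.1.adicCompletion L))⁻¹, Subgroup.inv_mem _ q.1.2, _, ⟨_, hq, (q.1 : GL (Fin 3) (w.1.adicCompletion L)), q.1.2, rfl⟩, ?_⟩
      simp only [← mul_assoc, inv_mul_cancel, one_mul, inv_mul_cancel_right]
      rw [hm]
    have hSfin : (κ.prod μU) (S (k * y n * k⁻¹)) < ⊤ := by
      refine (measure_mono hsub).trans_lt ?_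
      rw [Measure.prod_prod, hκ1, one_mul]
      exact hTc.measure_lt_top
    have hreal : (κ.prod μU).real (S (k * y n * k⁻¹)) ≠ 0 := by
      rw [measureReal_def]
      exact (ENNReal.toReal_pos hSpos.ne' hSfin.ne).ne'
    rw [hval]
    exact mul_ne_zero (mul_ne_zero (Complex.ofReal_ne_zero.2 (K2E3GermConstantRegularHRSplit.prefactor_ne_zero L H' hherm hH'd v w hw νHv νGv))
      (Units.ne_zero _)) (mul_ne_zero (Units.ne_zero _) (Complex.ofReal_ne_zero.2 hreal))
  -- (6) the kit's criterion: `Φ^st_H(fH′₂)(γ_n) ≠ 0` for `n ≫ 0`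
  have hne₂ := hcrit _ hs₂ hcoh₂ hpos₂
  -- (7) germ pairs from (GS) and the determinant
  obtain ⟨a₁, b₁, hev₁, hvalc₁⟩ := hGS _ hs₁
  obtain ⟨a₂, b₂, hev₂, hvalc₂⟩ := hGS _ hs₂
  have hφ₁z := hval₁
  rw [hvalc₁] at hφ₁z
  rw [hφ₂z] at hvalc₂
  have hdet : a₁ * b₂ - a₂ * b₁ ≠ 0 := by
    intro hd
    have hab : a₂ = 0 ∧ b₂ = 0 := by
      by_cases ha₁ : a₁ = 0
      · rw [ha₁, mul_zero, zero_add] at hφ₁z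
        have hb₁ : b₁ ≠ 0 := fun h => hφ₁z (by rw [h, mul_zero])
        have hl' : lam' ≠ 0 := fun h => hφ₁z (by rw [h, zero_mul])
        rw [ha₁, zero_mul, zero_sub, neg_eq_zero, mul_eq_zero] at hd
        have ha₂ : a₂ = 0 := hd.resolve_right hb₁
        refine ⟨ha₂, ?_⟩
        rw [ha₂, mul_zero, zero_add] at hvalc₂
        exact (mul_eq_zero.1 hvalc₂.symm).resolve_left hl'
      · have h1 : a₂ * (lam * a₁ + lam' * b₁) = a₁ * (lam * a₂ + lam' * b₂) := by linear_combination (-lam') * hd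
        rw [← hvalc₂, mul_zero] at h1
        have ha₂ : a₂ = 0 := (mul_eq_zero.1 h1).resolve_right hφ₁z
        refine ⟨ha₂, ?_⟩
        rw [ha₂, zero_mul, sub_zero] at hd
        exact (mul_eq_zero.1 hd).resolve_left ha₁
    obtain ⟨n, hn, hn'⟩ := (hev₂.and hne₂).exists
    rw [hab.1, hab.2, zero_mul, add_zero] at hn
    exact hn' hn
  -- (8) assemble
  exact ⟨γ, G, lam, lam', hreg, hlim, hG, hlam, hGS,
    ⟨_, _, a₁, b₁, a₂, b₂, hs₁, hs₂, hev₁, hev₂, hdet⟩,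
    ⟨f₁, f₂, _, _, a₁, b₁, a₂, b₂, hf₁, hf₂, hs₁, hs₂, htr₁, htr₂, hev₁, hev₂, hdet⟩⟩

end Summit.HodgeConjecture.HodgeConjecture.Cruxes.H413.K2E4SplitTransferRankTwo

end
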